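import Literature.Geometry.Lorentzian.BoundaryGeodesicAgreement
import Literature.Geometry.Lorentzian.SubdevelopmentCausalConvexity
import Literature.Geometry.Lorentzian.CommonDevelopmentRigidity
import Literature.Geometry.Lorentzian.CausalityClosedProofs
import Literature.Geometry.Lorentzian.CommonDevelopmentRestartAssembly
import HarnessLib

/-!
# `ψ = φ` on `U ∩ N`: an isometric immersion of a common development and the immersion of the
# development of a restarting hypersurface agree (Sbierski 2016, §3.2, proof of Thm. 12)

J. Sbierski, *On the existence of a maximal Cauchy development for the Einstein equations: a
dezornification*, Ann. Henri Poincaré 17 (2016) 301–329 = arXiv:1309.7591v3, §3.2, proof of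
Theorem 12 (arXiv numbering): *"We now claim that `ψ = φ` holds in `N ∩ Ū`, which would imply that
we can extend `ψ` to an isometric embedding `Ψ : U ∪ N → M'`. By the same argument as in the proof
of Corollary 8 we obtain `(dψ)|_S = (dφ)|_S`. The same continuity argument as in the proof of
Lemma 7, but this time applied to `N ∩ Ū`, now proves the claim."*

Here `U` is a common globally hyperbolic development of two developments `M`, `M'` with its
isometric immersion `ψ : U → M'`, `S ⊆ Ū` a spacelike hypersurface through a boundary point, lying
to the future of the data hypersurface, `N` a globally hyperbolic development of the data induced
on `S` realised in `M` — so `S` is a Cauchy hypersurface of `N` — and `φ : N → M'` the isometric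
immersion with `φ|_S = ψ|_S` supplied by the local uniqueness theorem. We prove the claim on
`U ∩ N` (which is what the extension `Ψ = ψ ∪ φ` needs,
`CommonDevelopment.exists_isCommonDevelopment_lt_of_restart` in
`CommonDevelopmentRestartAssembly.lean`) in the following form
(`LorentzianMetric.eq_of_restart`, `CauchyDevelopment.CommonDevelopment.map_eq_of_restart`):
`(M, g, τ)` a time-oriented Lorentzian manifold with an achronal set `Σ` (the data hypersurface);
`U ⊆ M` open with `Σ ∩ U` a Cauchy hypersurface of `(U, g|_U, τ|_U)`; `N ⊆ I⁺(Σ)` open; `S ⊆ N`,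
`S ⊆ closure U`, `S ∩ N` a Cauchy hypersurface of `(N, g|_N, τ|_N)`; `ψ`, `φ` isometric
immersions of `(U, g|_U)`, `(N, g|_N)` into `(M', g')`; and **at every point `s ∈ S` a smooth local
extension `ψ̂` of `ψ` with the one-jet of `φ`** (`ψ̂ = ψ` on `W ∩ U` for an open `W ∋ s`,
`ψ̂ s = φ s`, `dψ̂_s = dφ_s`: at points of `S ∩ ∂U` this is Sbierski's Lemma 14 together with
"`(dψ)|_S = (dφ)|_S`"; at points of `S ∩ U` one takes `ψ̂ = ψ`). **Then `ψ = φ` on `U ∩ N`.**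

Proof (making the printed "continuity argument applied to `N ∩ Ū`" precise). Fix `p ∈ U ∩ N` and
run the endless timelike curve `Γ` of the sub-spacetime `N` through `p`
(`exists_isEndlessTimelikeCurve_through`); it meets the Cauchy hypersurface `S` of `N` at a point
`s = Γ t₁`. The open segment of `Γ` between `p` and `s` lies in `U`: its points are in
`I⁺(Σ) ⊇ N` and either `≪ p ∈ U` or `≪ s ∈ closure U` (no timelike entry into `U` from
`J⁺(Σ) ∖ U`, `IsAchronal.mem_opens_of_mem_chronologicalFuture` and its closure form,
`SubdevelopmentTimelikeEntry.lean`). By the boundary agreement lemma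
(`LorentzianMetric.exists_nhds_eq_of_jet_eq_boundary`, `BoundaryGeodesicAgreement.lean`, applied
at `s` for `τ` or for the reversed time orientation according as `s ≪ p` or `p ≪ s`) `ψ = φ` on
an open set `O ∩ U`, `O ⊆ N`, which the segment enters near `s`; so the connected component of
`p` in `U ∩ N` contains a point near which `ψ = φ`, and the rigidity of isometric immersions on a
connected open set (O'Neill 1983, Prop. 3.62 = Sbierski's Lemma 7,
`IsIsometricImmersion.eq_of_mfderiv_eq`) gives `ψ p = φ p`.

Everything is proved; no definitions, no named facts (D-0026).

## References

* J. Sbierski, Ann. Henri Poincaré 17 (2016) 301–329 = arXiv:1309.7591v3, §3.2, proof of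
  Thm. 12 (arXiv numbering). [Sbierski2016AHP]
* B. O'Neill, *Semi-Riemannian geometry with applications to relativity*, Academic Press 1983,
  Ch. 3, Prop. 3.62; Ch. 14, Lemma 14.3. [ONeillSemiRiemannian1983]
-/

noncomputable section

open Bundle Set Filter Function TopologicalSpace Topology
open scoped Manifold ContDiff Topology

namespace Literature.Geometry.Lorentzian

open Literature.Geometry.Riemannian

section Core

variable {d : ℕ} {M : Type*} [TopologicalSpace M] [ChartedSpace (EuclideanSpace ℝ (Fin d)) M]
  [IsManifold (𝓡 d) ∞ M] [T2Space M] [SecondCountableTopology M]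
  {M' : Type*} [TopologicalSpace M'] [ChartedSpace (EuclideanSpace ℝ (Fin d)) M']
  [IsManifold (𝓡 d) ∞ M'] [T2Space M']

namespace LorentzianMetric

variable {g : LorentzianMetric (𝓡 d) ∞ M} [g.HasLeviCivita]
  [CovariantDerivative.ContMDiffCovariantDerivative g.leviCivita 1] (τ : TimeOrientation g)
  {g' : PseudoRiemannianMetric (𝓡 d) ∞ (EuclideanSpace ℝ (Fin d)) (TangentSpace (𝓡 d) : M' → Type _)}
  [g'.HasLeviCivita] [CovariantDerivative.ContMDiffCovariantDerivative g'.leviCivita 1]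

omit [T2Space M] [SecondCountableTopology M] [g.HasLeviCivita]
  [CovariantDerivative.ContMDiffCovariantDerivative g.leviCivita 1] [g'.HasLeviCivita]
  [CovariantDerivative.ContMDiffCovariantDerivative g'.leviCivita 1] in
/-- **Rigidity on a connected component of `U ∩ N`.** If `ψ : (U, g|_U) → M'` and
`φ : (N, g|_N) → M'` are isometric immersions into an equidimensional pseudo-Riemannian manifold
which agree on a neighbourhood of a point `y` lying in the connected component of `p` in `U ∩ N`,
then `ψ p = φ p`: the restrictions of `ψ`, `φ` to that (open, connected) component are isometric
immersions with the same one-jet at `y` (Sbierski 2016, Lemma 7 = O'Neill 1983, Prop. 3.62,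
`IsIsometricImmersion.eq_of_mfderiv_eq`). [cite: Sbierski2016AHP, §3.1, Lemma 7 (arXiv numbering)] -/
theorem eq_of_eventuallyEq_of_mem_connectedComponentIn (U N : Opens M) {ψ : U → M'} {φ : N → M'}
    (hψ : (g.restrict PseudoRiemannianMetric.contMDiff_restrict_holds U).IsIsometricImmersion g' ψ)
    (hφ : (g.restrict PseudoRiemannianMetric.contMDiff_restrict_holds N).IsIsometricImmersion g' φ)
    {p y : M} (hpU : p ∈ U) (hpN : p ∈ N) (hy : y ∈ connectedComponentIn ((U : Set M) ∩ N) p)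
    (hagree : ∀ᶠ q in 𝓝 y, ∀ (hqU : q ∈ U) (hqN : q ∈ N), ψ ⟨q, hqU⟩ = φ ⟨q, hqN⟩) :
    ψ ⟨p, hpU⟩ = φ ⟨p, hpN⟩ := by
  haveI : LocallyConnectedSpace M :=
    ChartedSpace.locallyConnectedSpace (EuclideanSpace ℝ (Fin d)) M
  -- the component, an open connected sub-spacetime inside `U` and `N`
  set Wc : Opens M := ⟨connectedComponentIn ((U : Set M) ∩ N) p, (U.2.inter N.2).connectedComponentIn⟩
    with hWc
  have hpW : p ∈ Wc := mem_connectedComponentIn ⟨hpU, hpN⟩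
  have hWU : Wc ≤ U := fun q hq ↦ (connectedComponentIn_subset _ _ hq).1
  have hWN : Wc ≤ N := fun q hq ↦ (connectedComponentIn_subset _ _ hq).2
  haveI : ConnectedSpace Wc :=
    isConnected_iff_connectedSpace.mp ⟨⟨p, hpW⟩, isPreconnected_connectedComponentIn⟩
  set ψW : Wc → M' := ψ ∘ Opens.inclusion hWU with hψW
  set φW : Wc → M' := φ ∘ Opens.inclusion hWN with hφW
  have hψWi : (g.restrict PseudoRiemannianMetric.contMDiff_restrict_holds Wc).IsIsometricImmersion
      g' ψW :=
    g.isIsometricImmersion_comp_inclusion (by simp) PseudoRiemannianMetric.contMDiff_restrict_holds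
      g' hWU hψ
  have hφWi : (g.restrict PseudoRiemannianMetric.contMDiff_restrict_holds Wc).IsIsometricImmersion
      g' φW :=
    g.isIsometricImmersion_comp_inclusion (by simp) PseudoRiemannianMetric.contMDiff_restrict_holds
      g' hWN hφ
  -- the one-jets of `ψW`, `φW` agree at `y`
  have hyW : y ∈ Wc := hy
  have hev : ψW =ᶠ[𝓝 (⟨y, hyW⟩ : Wc)] φW := by
    have h := (continuous_subtype_val.tendsto (⟨y, hyW⟩ : Wc)).eventually hagree
    filter_upwards [h] with q hq
    exact hq (hWU q.2) (hWN q.2)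
  have h0 : ψW ⟨y, hyW⟩ = φW ⟨y, hyW⟩ := hev.eq_of_nhds
  have h1 : mfderiv (𝓡 d) (𝓡 d) ψW ⟨y, hyW⟩ = mfderiv (𝓡 d) (𝓡 d) φW ⟨y, hyW⟩ := hev.mfderiv_eq
  have key : ψW = φW := hψWi.eq_of_mfderiv_eq (WithTop.coe_le_coe.mpr le_top) rfl hφWi h0 h1
  exact congrFun key ⟨p, hpW⟩

/-- **`ψ = φ` on `U ∩ N` when `N` lies to the future of the data hypersurface** (Sbierski 2016,
§3.2, proof of Thm. 12, "`ψ = φ` holds in `N ∩ Ū`"; see the module docstring for the statement and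
the proof). Hypotheses: `Σ` achronal; `Σ ∩ U` a Cauchy hypersurface of `(U, g|_U, τ|_U)`;
`N ⊆ I⁺(Σ)`; `S ⊆ N`, `S ⊆ closure U`, `S ∩ N` a Cauchy hypersurface of `(N, g|_N, τ|_N)`; `ψ`,
`φ` isometric immersions of `g|_U`, `g|_N` into `g'`; and at every `s ∈ S` a smooth local extension
of `ψ` with the one-jet of `φ`. The instance hypotheses on `g|_U`, `g|_N` (Levi-Civita connections
and their smoothness) are those of `BoundaryGeodesicAgreement.lean`.
[cite: Sbierski2016AHP, §3.2, proof of Thm. 12 (arXiv numbering)] -/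
theorem eq_of_restart (U N : Opens M)
    [(g.toPseudoRiemannianMetric.restrict PseudoRiemannianMetric.contMDiff_restrict_holds U).HasLeviCivita]
    [CovariantDerivative.ContMDiffCovariantDerivative
      (g.toPseudoRiemannianMetric.restrict PseudoRiemannianMetric.contMDiff_restrict_holds U).leviCivita 1]
    [(g.toPseudoRiemannianMetric.restrict PseudoRiemannianMetric.contMDiff_restrict_holds N).HasLeviCivita]
    [CovariantDerivative.ContMDiffCovariantDerivative
      (g.toPseudoRiemannianMetric.restrict PseudoRiemannianMetric.contMDiff_restrict_holds N).leviCivita 1]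
    {Sig : Set M} (hSig : g.IsAchronal τ Sig)
    (hU : (g.restrict PseudoRiemannianMetric.contMDiff_restrict_holds U).IsCauchyHypersurface
      (τ.restrict PseudoRiemannianMetric.contMDiff_restrict_holds τ.contMDiff_restrict_holds U)
      (Subtype.val ⁻¹' Sig))
    (hNI : (N : Set M) ⊆ g.chronologicalFuture τ Sig)
    {S : Set M} (hSN : S ⊆ N) (hSU : S ⊆ closure (U : Set M))
    (hN : (g.restrict PseudoRiemannianMetric.contMDiff_restrict_holds N).IsCauchyHypersurface
      (τ.restrict PseudoRiemannianMetric.contMDiff_restrict_holds τ.contMDiff_restrict_holds N)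
      (Subtype.val ⁻¹' S))
    {ψ : U → M'} {φ : N → M'}
    (hψ : (g.restrict PseudoRiemannianMetric.contMDiff_restrict_holds U).IsIsometricImmersion g' ψ)
    (hφ : (g.restrict PseudoRiemannianMetric.contMDiff_restrict_holds N).IsIsometricImmersion g' φ)
    (hext : ∀ (s : M) (hs : s ∈ S), ∃ (W : Set M) (ψ' : M → M'), IsOpen W ∧ s ∈ W ∧
      ContMDiffOn (𝓡 d) (𝓡 d) ∞ ψ' W ∧ (∀ (q : M) (hq : q ∈ U), q ∈ W → ψ' q = ψ ⟨q, hq⟩) ∧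
      ψ' s = φ ⟨s, hSN hs⟩ ∧ mfderiv (𝓡 d) (𝓡 d) ψ' s = mfderiv (𝓡 d) (𝓡 d) φ ⟨s, hSN hs⟩)
    {p : M} (hpU : p ∈ U) (hpN : p ∈ N) : ψ ⟨p, hpU⟩ = φ ⟨p, hpN⟩ := by
  have hn2 : (2 : ℕ∞ω) ≤ ∞ := WithTop.coe_le_coe.mpr le_top
  set hres := (PseudoRiemannianMetric.contMDiff_restrict_holds (I := 𝓡 d) (n := (∞ : ℕ∞ω)) (M := M))
    with hres_def
  set hτ := τ.contMDiff_restrict_holds with hτ_def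
  -- the endless timelike curve of the sub-spacetime `N` through `p`, meeting `S` at `s = Γ t₁`
  obtain ⟨Γ, D, hΓ, h0D, hΓ0⟩ := exists_isEndlessTimelikeCurve_through (g := g.restrict hres N)
    (τ := τ.restrict hres hτ N) hn2 (⟨p, hpN⟩ : N)
  obtain ⟨t₁, ⟨ht₁D, ht₁S⟩, -⟩ := hN Γ D hΓ
  set ΓM : ℝ → M := Subtype.val ∘ Γ with hΓM
  have hΓMt : g.IsFutureTimelikeCurveOn τ ΓM D :=
    (isFutureTimelikeCurveOn_restrict_iff g τ hres hτ N).1 hΓ.2.1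
  have hΓN : ∀ t, ΓM t ∈ N := fun t ↦ (Γ t).2
  have hΓ0' : ΓM 0 = p := by simp only [hΓM, comp_apply, hΓ0]
  have hΓJ : ∀ t, ΓM t ∈ g.causalFuture τ Sig := fun t ↦
    chronologicalFuture_subset_causalFuture g τ Sig (hNI (hΓN t))
  set s : M := ΓM t₁ with hs_def
  have hsS : s ∈ S := ht₁S
  have hsN : s ∈ N := hΓN t₁
  obtain ⟨W, ψ', hWo, hsW, hψ's, hψ'ψ, h0, h1⟩ := hext s hsS
  -- chronological relations along `Γ`
  have hll : ∀ a b, a ∈ D → b ∈ D → a < b → ΓM b ∈ g.chronologicalFuture τ {ΓM a} :=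
    fun a b ha hb hab ↦ ⟨ΓM a, rfl, ΓM, a, b, hab, hΓMt.mono (hΓ.1.out ha hb), rfl, rfl⟩
  -- continuity of `Γ` on sub-intervals of `D`
  have hΓcont : ∀ a b, a ∈ D → b ∈ D → ContinuousOn ΓM (Icc a b) := fun a b ha hb ↦
    continuousOn_of_forall_continuousAt fun u hu ↦ (hΓMt u (hΓ.1.out ha hb hu)).1.continuousAt
  -- the conclusion from a point `y ∈ U ∩ N` near which `ψ = φ`, joined to `p` inside `U ∩ N`
  -- by a segment of `Γ`
  have conclude : ∀ (a b t : ℝ), a ∈ D → b ∈ D → t ∈ Icc a b → (0 : ℝ) ∈ Icc a b →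
      (∀ u ∈ Icc a b, ΓM u ∈ U) →
      (∀ᶠ q in 𝓝 (ΓM t), ∀ (hqU : q ∈ U) (hqN : q ∈ N), ψ ⟨q, hqU⟩ = φ ⟨q, hqN⟩) →
      ψ ⟨p, hpU⟩ = φ ⟨p, hpN⟩ := by
    intro a b t ha hb ht h0 hsegU hagree
    refine eq_of_eventuallyEq_of_mem_connectedComponentIn U N hψ hφ hpU hpN ?_ hagree
    have hsub : ΓM '' Icc a b ⊆ (U : Set M) ∩ N :=
      image_subset_iff.2 fun u hu ↦ ⟨hsegU u hu, hΓN u⟩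
    have hconn : IsPreconnected (ΓM '' Icc a b) := isPreconnected_Icc.image _ (hΓcont a b ha hb)
    have hpmem : p ∈ ΓM '' Icc a b := ⟨0, h0, hΓ0'⟩
    exact hconn.subset_connectedComponentIn hpmem hsub ⟨t, ht, rfl⟩
  rcases lt_trichotomy t₁ 0 with ht₁ | ht₁ | ht₁
  · /- `s ≪ p`: the segment `Γ((t₁, 0])` lies in `U`, and `ψ = φ` on the future timecone at `s` -/
    have hsegU : ∀ t ∈ Ioc t₁ 0, ΓM t ∈ U := by
      intro t ht
      rcases ht.2.eq_or_lt with rfl | hlt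
      · rw [hΓ0']; exact hpU
      have htD : t ∈ D := hΓ.1.out ht₁D h0D ⟨ht.1.le, ht.2⟩
      have hfut : p ∈ g.chronologicalFuture τ {ΓM t} := by
        rw [← hΓ0']; exact hll t 0 htD h0D hlt
      exact hSig.mem_opens_of_mem_chronologicalFuture hn2 hres hτ hU (hΓJ t) hpU hfut
    obtain ⟨O, hOo, -, hOagree, hOentry⟩ := exists_nhds_eq_of_jet_eq_boundary τ U N hsN hψ hφ
      hWo hsW hψ's hψ'ψ h0 h1 (N.2.mem_nhds hsN)
      (fun z hz y _ hyU _ hzy ↦ hSig.mem_opens_of_mem_chronologicalFuture hn2 hres hτ hU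
        (chronologicalFuture_subset_causalFuture g τ Sig (hNI hz)) hyU hzy)
    have hev := hOentry ΓM t₁ 0 ht₁ (hΓMt.mono (hΓ.1.out ht₁D h0D)) rfl
    obtain ⟨t, htO, htI⟩ := (hev.and (Ioo_mem_nhdsGT ht₁)).exists
    have htD : t ∈ D := hΓ.1.out ht₁D h0D ⟨htI.1.le, htI.2.le⟩
    refine conclude t 0 t htD h0D ⟨le_rfl, htI.2.le⟩ ⟨htI.2.le, le_rfl⟩
      (fun u hu ↦ hsegU u ⟨htI.1.trans_le hu.1, hu.2⟩) ?_
    filter_upwards [hOo.mem_nhds htO] with q hq hqU hqN using hOagree q hqU hqN hq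
  · /- `p = s ∈ S`: directly from the extension at `s` -/
    have hps : p = s := by rw [hs_def, ht₁, hΓ0']
    have hpW : p ∈ W := by rw [hps]; exact hsW
    have e1 : ψ' p = ψ ⟨p, hpU⟩ := hψ'ψ p hpU hpW
    have e2 : φ ⟨p, hpN⟩ = φ ⟨s, hsN⟩ := by
      congr 1
      exact Subtype.ext hps
    have e3 : ψ' p = ψ' s := by rw [hps]
    rw [← e1, e3, h0, e2]
  · /- `p ≪ s`: the segment `Γ([0, t₁))` lies in `U`, and `ψ = φ` on the past timecone at `s` -/
    have hsegU : ∀ t ∈ Ico 0 t₁, ΓM t ∈ U := by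
      intro t ht
      rcases ht.1.eq_or_lt with rfl | hlt
      · rw [hΓ0']; exact hpU
      have htD : t ∈ D := hΓ.1.out h0D ht₁D ⟨ht.1, ht.2.le⟩
      have hfut : s ∈ g.chronologicalFuture τ {ΓM t} := hll t t₁ htD ht₁D ht.2
      exact hSig.mem_opens_of_mem_closure_of_mem_chronologicalFuture hn2 hres hτ hU (hΓJ t)
        (hSU hsS) hfut
    -- the boundary agreement for the reversed time orientation
    obtain ⟨O, hOo, -, hOagree, hOentry⟩ := exists_nhds_eq_of_jet_eq_boundary τ.reverse U N hsN
      hψ hφ hWo hsW hψ's hψ'ψ h0 h1 (N.2.mem_nhds hsN)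
      (fun z hz y _ _ hsz _ ↦ hSig.mem_opens_of_mem_closure_of_mem_chronologicalFuture hn2 hres hτ
        hU (chronologicalFuture_subset_causalFuture g τ Sig (hNI hz)) (hSU hsS)
        (mem_chronologicalFuture_of_mem_chronologicalPast hsz))
    -- `Γ` read backwards from `s` is a future timelike curve for `-τ`
    have hc : g.IsFutureTimelikeCurveOn τ.reverse (fun u ↦ ΓM (-u)) (Icc (-t₁) 0) := by
      have h := (hΓMt.mono (hΓ.1.out h0D ht₁D)).comp_neg
      refine h.mono fun u hu ↦ ?_
      simp only [mem_preimage, mem_Icc] at hu ⊢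
      exact ⟨by linarith [hu.2], by linarith [hu.1]⟩
    have hev := hOentry (fun u ↦ ΓM (-u)) (-t₁) 0 (neg_lt_zero.2 ht₁) hc (by simp [hs_def])
    obtain ⟨u, huO, huI⟩ := (hev.and (Ioo_mem_nhdsGT (neg_lt_zero.2 ht₁))).exists
    have htI : -u ∈ Ioo 0 t₁ := ⟨by linarith [huI.2], by linarith [huI.1]⟩
    have htD : -u ∈ D := hΓ.1.out h0D ht₁D ⟨htI.1.le, htI.2.le⟩
    refine conclude 0 (-u) (-u) h0D htD ⟨htI.1.le, le_rfl⟩ ⟨le_rfl, htI.1.le⟩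
      (fun w hw ↦ hsegU w ⟨hw.1, hw.2.trans_lt htI.2⟩) ?_
    filter_upwards [hOo.mem_nhds huO] with q hq hqU hqN using hOagree q hqU hqN hq

/-- **Time dual: `ψ = φ` on `U ∩ N` when `N` lies to the PAST of the data hypersurface**
(`N ⊆ I⁻(Σ)`), by `eq_of_restart` for the reversed time orientation (achronality, the Cauchy
property of sub-spacetimes, isometric immersions and the extension data are unchanged; `I⁻` for
`τ` is `I⁺` for `-τ`). Sbierski 2016, §3.2 ("without loss of generality … otherwise we reverse the
time orientation"). [cite: Sbierski2016AHP, §3.2, proof of Thm. 12 and the remark after Lemma 15 (arXiv numbering)] -/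
theorem eq_of_restart_of_subset_chronologicalPast (U N : Opens M)
    [(g.toPseudoRiemannianMetric.restrict PseudoRiemannianMetric.contMDiff_restrict_holds U).HasLeviCivita]
    [CovariantDerivative.ContMDiffCovariantDerivative
      (g.toPseudoRiemannianMetric.restrict PseudoRiemannianMetric.contMDiff_restrict_holds U).leviCivita 1]
    [(g.toPseudoRiemannianMetric.restrict PseudoRiemannianMetric.contMDiff_restrict_holds N).HasLeviCivita]
    [CovariantDerivative.ContMDiffCovariantDerivative
      (g.toPseudoRiemannianMetric.restrict PseudoRiemannianMetric.contMDiff_restrict_holds N).leviCivita 1]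
    {Sig : Set M} (hSig : g.IsAchronal τ Sig)
    (hU : (g.restrict PseudoRiemannianMetric.contMDiff_restrict_holds U).IsCauchyHypersurface
      (τ.restrict PseudoRiemannianMetric.contMDiff_restrict_holds τ.contMDiff_restrict_holds U)
      (Subtype.val ⁻¹' Sig))
    (hNI : (N : Set M) ⊆ g.chronologicalPast τ Sig)
    {S : Set M} (hSN : S ⊆ N) (hSU : S ⊆ closure (U : Set M))
    (hN : (g.restrict PseudoRiemannianMetric.contMDiff_restrict_holds N).IsCauchyHypersurface
      (τ.restrict PseudoRiemannianMetric.contMDiff_restrict_holds τ.contMDiff_restrict_holds N)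
      (Subtype.val ⁻¹' S))
    {ψ : U → M'} {φ : N → M'}
    (hψ : (g.restrict PseudoRiemannianMetric.contMDiff_restrict_holds U).IsIsometricImmersion g' ψ)
    (hφ : (g.restrict PseudoRiemannianMetric.contMDiff_restrict_holds N).IsIsometricImmersion g' φ)
    (hext : ∀ (s : M) (hs : s ∈ S), ∃ (W : Set M) (ψ' : M → M'), IsOpen W ∧ s ∈ W ∧
      ContMDiffOn (𝓡 d) (𝓡 d) ∞ ψ' W ∧ (∀ (q : M) (hq : q ∈ U), q ∈ W → ψ' q = ψ ⟨q, hq⟩) ∧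
      ψ' s = φ ⟨s, hSN hs⟩ ∧ mfderiv (𝓡 d) (𝓡 d) ψ' s = mfderiv (𝓡 d) (𝓡 d) φ ⟨s, hSN hs⟩)
    {p : M} (hpU : p ∈ U) (hpN : p ∈ N) : ψ ⟨p, hpU⟩ = φ ⟨p, hpN⟩ := by
  have hU' : (g.restrict PseudoRiemannianMetric.contMDiff_restrict_holds U).IsCauchyHypersurface
      (τ.reverse.restrict PseudoRiemannianMetric.contMDiff_restrict_holds
        τ.reverse.contMDiff_restrict_holds U) (Subtype.val ⁻¹' Sig) := by
    have h := hU.reverse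
    rw [TimeOrientation.restrict_reverse] at h
    exact h
  have hN' : (g.restrict PseudoRiemannianMetric.contMDiff_restrict_holds N).IsCauchyHypersurface
      (τ.reverse.restrict PseudoRiemannianMetric.contMDiff_restrict_holds
        τ.reverse.contMDiff_restrict_holds N) (Subtype.val ⁻¹' S) := by
    have h := hN.reverse
    rw [TimeOrientation.restrict_reverse] at h
    exact h
  exact eq_of_restart τ.reverse U N hSig.reverse hU' hNI hSN hSU hN' hψ hφ hext hpU hpN

end LorentzianMetric

end Core

/-! ### The instance for common globally hyperbolic developments -/

section Developments

universe u

variable {n : ℕ} {X : Type u} [TopologicalSpace X] [ChartedSpace (EuclideanSpace ℝ (Fin n)) X]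
  [IsManifold (𝓡 n) ∞ X] [ConnectedSpace X] {D : InitialDataSet (𝓡 n) X}

namespace CauchyDevelopment

namespace CommonDevelopment

variable {𝒟 𝒟' : CauchyDevelopment D} (𝔠 : CommonDevelopment 𝒟 𝒟')

/-- **`ψ = φ` on `U ∩ N` for a common globally hyperbolic development** (Sbierski 2016, §3.2,
proof of Thm. 12: "`ψ = φ` holds in `N ∩ Ū`"). Let `(U, ψ)` be a common development of the Cauchy
developments `𝒟`, `𝒟'`, `N ⊆ M` open lying to the future or to the past of the data hypersurface
`ι(X)`, `S ⊆ N ∩ closure U` with `S ∩ N` a Cauchy hypersurface of `(N, g|_N, τ|_N)`,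
`φ : (N, g|_N) → M'` an isometric immersion, and suppose that at every point of `S` the map `ψ`
has a smooth local extension with the one-jet of `φ` (Lemma 14 at the points of `S ∩ ∂U`; `ψ`
itself at the points of `S ∩ U`). Then `ψ = φ` on `U ∩ N`
(`LorentzianMetric.eq_of_restart` / `…_of_subset_chronologicalPast`, the Levi-Civita instances of
the metrics involved being discharged by `PseudoRiemannianMetric.hasLeviCivita` and
`isLocallyContMDiff_leviCivita_holds`). [cite: Sbierski2016AHP, §3.2, proof of Thm. 12 (arXiv numbering)] -/
theorem map_eq_of_restart {N : Opens 𝒟.carrier}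
    (hNI : (N : Set 𝒟.carrier) ⊆ 𝒟.metric.chronologicalFuture 𝒟.timeOrientation (range 𝒟.embed) ∨
      (N : Set 𝒟.carrier) ⊆ 𝒟.metric.chronologicalPast 𝒟.timeOrientation (range 𝒟.embed))
    {S : Set 𝒟.carrier} (hSN : S ⊆ N) (hSU : S ⊆ closure (𝔠.opens : Set 𝒟.carrier))
    (hN : (𝒟.metric.restrict PseudoRiemannianMetric.contMDiff_restrict_holds N).IsCauchyHypersurface
      (𝒟.timeOrientation.restrict PseudoRiemannianMetric.contMDiff_restrict_holds
        𝒟.timeOrientation.contMDiff_restrict_holds N) (Subtype.val ⁻¹' S))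
    {φ : N → 𝒟'.carrier}
    (hφ : (𝒟.metric.restrict PseudoRiemannianMetric.contMDiff_restrict_holds N).IsIsometricImmersion
      𝒟'.metric.toPseudoRiemannianMetric φ)
    (hext : ∀ (s : 𝒟.carrier) (hs : s ∈ S), ∃ (W : Set 𝒟.carrier) (ψ' : 𝒟.carrier → 𝒟'.carrier),
      IsOpen W ∧ s ∈ W ∧ ContMDiffOn (𝓡 (n + 1)) (𝓡 (n + 1)) ∞ ψ' W ∧
      (∀ (q : 𝒟.carrier) (hq : q ∈ 𝔠.opens), q ∈ W → ψ' q = 𝔠.map ⟨q, hq⟩) ∧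
      ψ' s = φ ⟨s, hSN hs⟩ ∧
      mfderiv (𝓡 (n + 1)) (𝓡 (n + 1)) ψ' s = mfderiv (𝓡 (n + 1)) (𝓡 (n + 1)) φ ⟨s, hSN hs⟩)
    {p : 𝒟.carrier} (hpU : p ∈ 𝔠.opens) (hpN : p ∈ N) : 𝔠.map ⟨p, hpU⟩ = φ ⟨p, hpN⟩ := by
  have hn2 : (2 : ℕ∞ω) ≤ ∞ := WithTop.coe_le_coe.mpr le_top
  have hk : ((1 : ℕ∞) : ℕ∞ω) + 1 ≤ ∞ := by
    rw [show ((1 : ℕ∞) : ℕ∞ω) + 1 = 2 by norm_num]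
    exact WithTop.coe_le_coe.2 le_top
  haveI : Fact ((1 : ℕ∞ω) ≤ ∞) := ⟨by exact_mod_cast (le_top : (1 : ℕ∞) ≤ ⊤)⟩
  -- Levi-Civita connections of `g`, `g|_U`, `g|_N`, `g'`, and their smoothness
  haveI := 𝒟.metric.toPseudoRiemannianMetric.hasLeviCivita
  haveI : CovariantDerivative.ContMDiffCovariantDerivative 𝒟.metric.leviCivita 1 :=
    ⟨𝒟.metric.toPseudoRiemannianMetric.isLocallyContMDiff_leviCivita_holds 1 hk univ isOpen_univ⟩
  haveI := (𝒟.metric.toPseudoRiemannianMetric.restrict PseudoRiemannianMetric.contMDiff_restrict_holds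
    𝔠.opens).hasLeviCivita
  haveI : CovariantDerivative.ContMDiffCovariantDerivative
      (𝒟.metric.toPseudoRiemannianMetric.restrict PseudoRiemannianMetric.contMDiff_restrict_holds
        𝔠.opens).leviCivita 1 :=
    ⟨(𝒟.metric.toPseudoRiemannianMetric.restrict PseudoRiemannianMetric.contMDiff_restrict_holds
      𝔠.opens).isLocallyContMDiff_leviCivita_holds 1 hk univ isOpen_univ⟩
  haveI := (𝒟.metric.toPseudoRiemannianMetric.restrict PseudoRiemannianMetric.contMDiff_restrict_holds
    N).hasLeviCivita
  haveI : CovariantDerivative.ContMDiffCovariantDerivative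
      (𝒟.metric.toPseudoRiemannianMetric.restrict PseudoRiemannianMetric.contMDiff_restrict_holds
        N).leviCivita 1 :=
    ⟨(𝒟.metric.toPseudoRiemannianMetric.restrict PseudoRiemannianMetric.contMDiff_restrict_holds
      N).isLocallyContMDiff_leviCivita_holds 1 hk univ isOpen_univ⟩
  haveI := 𝒟'.metric.toPseudoRiemannianMetric.hasLeviCivita
  haveI : CovariantDerivative.ContMDiffCovariantDerivative 𝒟'.metric.leviCivita 1 :=
    ⟨𝒟'.metric.toPseudoRiemannianMetric.isLocallyContMDiff_leviCivita_holds 1 hk univ isOpen_univ⟩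
  have hach : 𝒟.metric.IsAchronal 𝒟.timeOrientation (range 𝒟.embed) :=
    LorentzianMetric.IsCauchyHypersurface.isAchronal_holds hn2 𝒟.isCauchyHypersurface
  rcases hNI with hNI | hNI
  · exact LorentzianMetric.eq_of_restart 𝒟.timeOrientation 𝔠.opens N hach 𝔠.isCauchyHypersurface
      hNI hSN hSU hN 𝔠.isIsometricImmersion hφ hext hpU hpN
  · exact LorentzianMetric.eq_of_restart_of_subset_chronologicalPast 𝒟.timeOrientation 𝔠.opens N
      hach 𝔠.isCauchyHypersurface hNI hSN hSU hN 𝔠.isIsometricImmersion hφ hext hpU hpN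

/-- **The extension step of Sbierski's Theorem 12, with the agreement discharged.** Under the
hypotheses of `map_eq_of_restart`, if moreover `φ` preserves the time orientations and `N ⊄ U`,
then some common globally hyperbolic development strictly contains `U`
(`exists_isCommonDevelopment_lt_of_restart`, `CommonDevelopmentRestartAssembly.lean`).
[cite: Sbierski2016AHP, §3.2, proof of Thm. 12 (arXiv numbering)] -/
theorem exists_isCommonDevelopment_lt_of_restart_jet {N : Opens 𝒟.carrier}
    (hNI : (N : Set 𝒟.carrier) ⊆ 𝒟.metric.chronologicalFuture 𝒟.timeOrientation (range 𝒟.embed) ∨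
      (N : Set 𝒟.carrier) ⊆ 𝒟.metric.chronologicalPast 𝒟.timeOrientation (range 𝒟.embed))
    {S : Set 𝒟.carrier} (hSN : S ⊆ N) (hSU : S ⊆ closure (𝔠.opens : Set 𝒟.carrier))
    (hN : (𝒟.metric.restrict PseudoRiemannianMetric.contMDiff_restrict_holds N).IsCauchyHypersurface
      (𝒟.timeOrientation.restrict PseudoRiemannianMetric.contMDiff_restrict_holds
        𝒟.timeOrientation.contMDiff_restrict_holds N) (Subtype.val ⁻¹' S))
    {φ : N → 𝒟'.carrier}
    (hφ : (𝒟.metric.restrict PseudoRiemannianMetric.contMDiff_restrict_holds N).IsIsometricImmersion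
      𝒟'.metric.toPseudoRiemannianMetric φ)
    (hφτ : (𝒟.timeOrientation.restrict PseudoRiemannianMetric.contMDiff_restrict_holds
      𝒟.timeOrientation.contMDiff_restrict_holds N).PreservesTimeOrientation φ 𝒟'.timeOrientation)
    (hext : ∀ (s : 𝒟.carrier) (hs : s ∈ S), ∃ (W : Set 𝒟.carrier) (ψ' : 𝒟.carrier → 𝒟'.carrier),
      IsOpen W ∧ s ∈ W ∧ ContMDiffOn (𝓡 (n + 1)) (𝓡 (n + 1)) ∞ ψ' W ∧
      (∀ (q : 𝒟.carrier) (hq : q ∈ 𝔠.opens), q ∈ W → ψ' q = 𝔠.map ⟨q, hq⟩) ∧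
      ψ' s = φ ⟨s, hSN hs⟩ ∧
      mfderiv (𝓡 (n + 1)) (𝓡 (n + 1)) ψ' s = mfderiv (𝓡 (n + 1)) (𝓡 (n + 1)) φ ⟨s, hSN hs⟩)
    (hNU : ¬ ((N : Set 𝒟.carrier) ⊆ 𝔠.opens)) :
    ∃ V : Opens 𝒟.carrier, 𝒟.IsCommonDevelopment 𝒟'.toDataEmbedding V ∧ 𝔠.opens < V :=
  𝔠.exists_isCommonDevelopment_lt_of_restart hN hSU hφ hφτ
    (fun _ hU hpN ↦ 𝔠.map_eq_of_restart hNI hSN hSU hN hφ hext hU hpN) hNU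

end CommonDevelopment

end CauchyDevelopment

end Developments

/-! ### Sbierski's Theorem 12 from the restart data, agreement discharged -/

/-- **Sbierski's Theorem 12 follows from the geometric restart data.** If every common globally
hyperbolic development `(U, ψ)` of two vacuum developments of the same data with corresponding
boundary points admits: an open `N ⊆ M` to the future or to the past of the data hypersurface, a
set `S ⊆ N ∩ closure U` with `S ∩ N` a Cauchy hypersurface of `(N, g|_N, τ|_N)`, a
time-orientation preserving isometric immersion `φ : (N, g|_N) → M'`, smooth local extensions of
`ψ` with the one-jet of `φ` at the points of `S`, and a point of `N` outside `U` — in the printed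
proof: `S` the level set of `τ_q` through a boundary point (Lemmas 15, 16), `N`, `φ` from the
local existence and uniqueness theorem on `S` (Thm. 4), the extensions from Lemma 14 — then the
named fact `sbierski_commonDevelopment_lt_of_hasCorrespondingBoundaryPoints` holds.
[cite: Sbierski2016AHP, §3.2, Thm. 12 and its proof (arXiv numbering)] -/
theorem sbierski_commonDevelopment_lt_of_restart_jet
    (hrestart : ∀ (N : Type) [TopologicalSpace N] [ChartedSpace (EuclideanSpace ℝ (Fin 3)) N]
      [IsManifold (𝓡 3) ∞ N] [ConnectedSpace N] (D₁ : InitialDataSet (𝓡 3) N)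
      (𝒟₁ 𝒟₂ : VacuumCauchyDevelopment D₁)
      (𝔠 : CauchyDevelopment.CommonDevelopment 𝒟₁.toCauchyDevelopment 𝒟₂.toCauchyDevelopment),
      𝔠.HasCorrespondingBoundaryPoints →
        ∃ (N' : Opens 𝒟₁.carrier) (S : Set 𝒟₁.carrier) (φ : N' → 𝒟₂.carrier) (hSN : S ⊆ N'),
          ((N' : Set 𝒟₁.carrier) ⊆
              𝒟₁.metric.chronologicalFuture 𝒟₁.timeOrientation (range 𝒟₁.embed) ∨
            (N' : Set 𝒟₁.carrier) ⊆
              𝒟₁.metric.chronologicalPast 𝒟₁.timeOrientation (range 𝒟₁.embed)) ∧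
          S ⊆ closure (𝔠.opens : Set 𝒟₁.carrier) ∧
          (𝒟₁.metric.restrict PseudoRiemannianMetric.contMDiff_restrict_holds N').IsCauchyHypersurface
            (𝒟₁.timeOrientation.restrict PseudoRiemannianMetric.contMDiff_restrict_holds
              𝒟₁.timeOrientation.contMDiff_restrict_holds N') (Subtype.val ⁻¹' S) ∧
          (𝒟₁.metric.restrict PseudoRiemannianMetric.contMDiff_restrict_holds N').IsIsometricImmersion
            𝒟₂.metric.toPseudoRiemannianMetric φ ∧
          (𝒟₁.timeOrientation.restrict PseudoRiemannianMetric.contMDiff_restrict_holds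
            𝒟₁.timeOrientation.contMDiff_restrict_holds N').PreservesTimeOrientation φ
              𝒟₂.timeOrientation ∧
          (∀ (s : 𝒟₁.carrier) (hs : s ∈ S), ∃ (W : Set 𝒟₁.carrier) (ψ' : 𝒟₁.carrier → 𝒟₂.carrier),
            IsOpen W ∧ s ∈ W ∧ ContMDiffOn (𝓡 4) (𝓡 4) ∞ ψ' W ∧
            (∀ (q : 𝒟₁.carrier) (hq : q ∈ 𝔠.opens), q ∈ W → ψ' q = 𝔠.map ⟨q, hq⟩) ∧
            ψ' s = φ ⟨s, hSN hs⟩ ∧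
            mfderiv (𝓡 4) (𝓡 4) ψ' s = mfderiv (𝓡 4) (𝓡 4) φ ⟨s, hSN hs⟩) ∧
          ¬ ((N' : Set 𝒟₁.carrier) ⊆ 𝔠.opens)) :
    sbierski_commonDevelopment_lt_of_hasCorrespondingBoundaryPoints := by
  intro N _ _ _ _ D₁ 𝒟₁ 𝒟₂ 𝔠 h𝔠
  obtain ⟨N', S, φ, hSN, hNI, hSU, hN', hφ, hφτ, hext, hNU⟩ := hrestart N D₁ 𝒟₁ 𝒟₂ 𝔠 h𝔠
  exact 𝔠.exists_isCommonDevelopment_lt_of_restart_jet hNI hSN hSU hN' hφ hφτ hext hNU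

end Literature.Geometry.Lorentzian

end
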